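import Summits.QuantumFields.BalabanUV.T4Continuum.Support.ScalarBlockPoincare

/-!
# T⁴ programme, spine node NE2 (U1a), lane P2 — SUPPLIER s5a (ONE⁰-pos), file 1: THE SMOOTHED PLANTING `A(P f)` — a one-step
# competitor in POSITION SPACE whose fine Dirichlet energy is at most the coarse one with constant EXACTLY 1 (every `L`, every torus)

NE2 formalisation swarm `b2b-balaban-t4-ne2-formalise-*`, leaf 04 GEN 2, supplier item «P2-SUPPLIER s5a = ONE⁰-pos» (journal INTENT
CLAIMS.log l.8445) for leaf ONE⁺ of the P2 (variational) skeleton `t4/skeletons/NE2-t4-ne2-p2.md` v0.6 §2.C («one-step consistency at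
the coarse minimiser … EXPLICIT competitor … no fine minimiser, no Fourier»).  The route's tier-0 one-step consistency (`VariationalOneStepSymbol`)
is a FOURIER statement and cannot carry a background; ONE⁺ needs a position-space competitor that can be dressed with transport phases
exactly as FED⁺ (`VariationalCovariantFederbush`) dresses Federbush's inequality.  This file builds its `U = 1` core.

THE CONSTRUCTION.  Coarse torus `Tor N`, fine torus `Tor (fine L N)` with blocks `B(y) = {bpt L N y j}` ([Balaban1984PropagatorsI] (1.6);
tree `B5Block118.bpt`, `B5Blocks16.blockOf`).  For a coarse function `f`:
 * the PLANTING `plant f := f ∘ blockOf` (piecewise constant on blocks);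
 * the forward BOX AVERAGE `boxAvg g = L^{−d}Σ_j g(· + ιj)` (tree `ScalarBlockPoincare.boxAvg`) and its backward twin
   `boxAvgNeg g := (boxAvg g)(· − ι j_max)`, `j_max = (L−1,…,L−1)`; their composite `smooth := boxAvg ∘ boxAvgNeg` is the separable
   FEJÉR (triangle) smoothing `L^{−2d}Σ_{j,j′} g(· + ιj − ιj′)`, a symmetric average of translates;
 * the competitor of this file is `smooth (plant f)`.
THE THEOREMS ([folklore] lattice calculus; every `L ≥ 1`, every torus `N`):
 * §2 averages of translates are `ℓ²`-contractions (Jensen: `nsq_avg_transS_le`), so are `boxAvg`, `boxAvgNeg`, `smooth` and the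
   transverse box average `boxAvgT μ` (over the offsets with `j_μ = 0`); all commute with translations;
 * §3 THE TELESCOPING IDENTITY `(S_μ − 1)∘boxAvg = L⁻¹·boxAvgT μ∘(S_μ^L − 1)` (`transS_sub_boxAvg`) — the forward difference of a
   box average telescopes along the `μ`-digit — and the BLOCK SHIFT `S_μ^L∘plant = plant∘σ_μ` (`transS_blockStep_plant`, from the tree's
   `bpt_add_tstep`);
 * §4 **`nsq_fdiff_smooth_plant_le`**: `nsq (S_μ(A P f) − A P f) ≤ L^d/L²·nsq (σ_μ f − f)` — in physical units `Sf(A P f) ≤ Sc(f)` with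
   constant EXACTLY 1 (Federbush-sharp: `Sf(f′) ≥ Sc(Q f′)` for every `f′`), and the second-difference bound
   **`nsq_fdiff2_smooth_plant_le`**: `nsq ((S_μ − 1)²(A P f)) ≤ L^d/L⁴·nsq ((σ_μ − 1)² f)` (the input of the cross term of file 3).
Files 2/3 of the item: the block MEANS of `A P f` (first order cancels by reflection symmetry) and the trial-function correction.

HONEST FRAMING (T4-DAG p. 1).  `U = 1`; [folklore] lattice analysis on the cell's carriers; statements and constants OURS; nothing
printed is a hypothesis; no `def … : Prop`; no `sorry`; axioms standard.  A SUPPLIER engine for ONE⁺ — NOT ONE⁺ with background, NOT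
NE2⁺; NE2 NOT proved; spine 0/9; rung (B)+1 finite T⁴ — NOT infinite volume, NOT mass gap, NOT Clay.  HONEST DEPENDENCY (cell, verbatim):
continuum YM on T⁴ ⇐ BetaPertH ∧ nine spine estimates (0/9 proved); BetaPertH ⇐ (D1) ∧ (D4) ∧ CAP+tail; G-an2-4 gates asym, D1 and NE2/3/4.
-/

noncomputable section

open scoped BigOperators Matrix
open Finset

namespace Summit.QuantumFields.BalabanUV.T4Continuum.VariationalSmoothedPlanting

open Literature.MathematicalPhysics.QuantumFieldTheory.Balaban1983to89.B5Prop11Plancherel (Tor fine unitVec)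
open Literature.MathematicalPhysics.QuantumFieldTheory.Balaban1983to89.B5Prop11Lower (nsq nsq_nonneg)
open Literature.MathematicalPhysics.QuantumFieldTheory.Balaban1983to89.B5Block118 (tstep tstep_zero tstep_succ up iota bpt QsOp
  QsOp_mulVec bpt_add_tstep)
open Literature.MathematicalPhysics.QuantumFieldTheory.Balaban1983to89.B5Blocks16 (bpt_bijective blockOf blockOf_bpt)
open Literature.MathematicalPhysics.QuantumFieldTheory.Balaban1983to89.B5AverageCurlStokes (sum_blocks_real)
open Summit.QuantumFields.BalabanUV.T4Continuum.ScalarBlockPoincare (nsq_sum_le nsq_smul transS transS_zero transS_add transS_sub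
  nsq_transS transS_tstep_sub boxAvg)

variable {d : ℕ}

/-! ## §1 Planting -/
section Plant

variable (L : ℕ) [NeZero L] (N : Fin d → ℕ) [hN : ∀ μ, NeZero (N μ)]

/-- the PLANTING of a coarse function: `(P f)(x) = f(block of x)` (piecewise constant on the blocks `B(y)`). [folklore] -/
def plant (f : Tor N → ℂ) : Tor (fine L N) → ℂ := fun x => f (blockOf L N x)

/-- `(P f)(L·y + j) = f(y)`. [folklore] -/
theorem plant_bpt (f : Tor N → ℂ) (y : Tor N) (j : Fin d → Fin L) : plant L N f (bpt L N y j) = f y := by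
  rw [plant, blockOf_bpt]

/-- every fine site is a block point. [folklore] -/
theorem exists_bpt (x : Tor (fine L N)) : ∃ y j, x = bpt L N y j := by
  obtain ⟨⟨y, j⟩, h⟩ := (bpt_bijective L N).2 x
  exact ⟨y, j, h.symm⟩

/-- planting is linear: differences. [folklore] -/
theorem plant_sub (f g : Tor N → ℂ) : plant L N (f - g) = plant L N f - plant L N g := rfl

/-- `nsq (P f) = L^d·nsq f`. [folklore] -/
theorem nsq_plant (f : Tor N → ℂ) : nsq (plant L N f) = (L : ℝ) ^ d * nsq f := by
  have hcard : (Fintype.card (Fin d → Fin L) : ℝ) = (L : ℝ) ^ d := by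
    rw [Fintype.card_fun, Fintype.card_fin, Fintype.card_fin]; push_cast; ring
  unfold nsq
  rw [sum_blocks_real L N (fun x => ‖plant L N f x‖ ^ 2), Finset.mul_sum]
  refine Finset.sum_congr rfl fun y _ => ?_
  simp only [plant_bpt, Finset.sum_const, Finset.card_univ, nsmul_eq_mul, hcard]

/-- **BLOCK SHIFT**: translating the planting by one block is planting the translated function, `S_μ^L∘P = P∘σ_μ`. [folklore] -/
theorem transS_blockStep_plant (f : Tor N → ℂ) (μ : Fin d) :
    transS (fine L N) (tstep (fine L N) μ L) (plant L N f) = plant L N (transS N (unitVec N μ) f) := by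
  funext x
  obtain ⟨y, j, rfl⟩ := exists_bpt L N x
  simp only [transS, plant]
  rw [bpt_add_tstep, blockOf_bpt, blockOf_bpt]

/-- the block means of the planting are the planted function: `Q(P f) = f`. [folklore] -/
theorem QsOp_plant (f : Tor N → ℂ) : QsOp L N *ᵥ plant L N f = f := by
  have hL : ((L : ℂ) ^ d) ≠ 0 := pow_ne_zero _ (by exact_mod_cast NeZero.ne L)
  have hcard : (Fintype.card (Fin d → Fin L) : ℂ) = (L : ℂ) ^ d := by
    rw [Fintype.card_fun, Fintype.card_fin, Fintype.card_fin]; push_cast; ring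
  funext y
  rw [QsOp_mulVec]
  simp only [plant_bpt, Finset.sum_const, Finset.card_univ, nsmul_eq_mul, hcard]
  field_simp

end Plant

/-! ## §2 Averages of translates are contractions; box averages -/
section Averages

variable (N : Fin d → ℕ) [hN : ∀ μ, NeZero (N μ)]

/-- **JENSEN FOR TRANSLATES**: the mean of `|s|` translates of `g` has `nsq ≤ nsq g`. [folklore] -/
theorem nsq_avg_transS_le {ι : Type*} (s : Finset ι) (v : ι → Tor N) (g : Tor N → ℂ) :
    nsq (((s.card : ℂ))⁻¹ • ∑ i ∈ s, transS N (v i) g) ≤ nsq g := by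
  rcases Nat.eq_zero_or_pos s.card with h0 | hpos
  · rw [Finset.card_eq_zero.mp h0]
    simp only [Finset.card_empty, Nat.cast_zero, inv_zero, Finset.sum_empty, smul_zero]
    have : nsq (0 : Tor N → ℂ) = 0 := by simp [nsq]
    rw [this]; exact nsq_nonneg g
  have hc : (0 : ℝ) < s.card := by exact_mod_cast hpos
  rw [nsq_smul, norm_inv, Complex.norm_natCast]
  have h1 := nsq_sum_le s (fun i => transS N (v i) g)
  have h2 : ∑ i ∈ s, nsq (transS N (v i) g) = s.card * nsq g := by
    rw [Finset.sum_congr rfl fun i _ => nsq_transS N (v i) g, Finset.sum_const, nsmul_eq_mul]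
  rw [h2] at h1
  calc ((s.card : ℝ)⁻¹) ^ 2 * nsq (∑ i ∈ s, transS N (v i) g) ≤ ((s.card : ℝ)⁻¹) ^ 2 * (s.card * (s.card * nsq g)) :=
        mul_le_mul_of_nonneg_left h1 (by positivity)
    _ = nsq g := by field_simp

omit hN in
/-- translations are additive over finite sums. [folklore] -/
theorem transS_finset_sum {ι : Type*} (s : Finset ι) (w : Tor N) (h : ι → Tor N → ℂ) :
    transS N w (∑ i ∈ s, h i) = ∑ i ∈ s, transS N w (h i) := by
  funext x
  simp only [transS, Finset.sum_apply]

omit hN in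
/-- translations commute with finite sums of translations. [folklore] -/
theorem transS_sum {ι : Type*} (s : Finset ι) (v : ι → Tor N) (w : Tor N) (g : Tor N → ℂ) :
    transS N w (∑ i ∈ s, transS N (v i) g) = ∑ i ∈ s, transS N (v i) (transS N w g) := by
  funext x
  simp only [transS, Finset.sum_apply]
  exact Finset.sum_congr rfl fun i _ => by rw [add_right_comm]

omit hN in
/-- translations commute with scalar multiples. [folklore] -/
theorem transS_smul (w : Tor N) (c : ℂ) (g : Tor N → ℂ) : transS N w (c • g) = c • transS N w g := rfl

end Averages
section Boxes

variable (L : ℕ) [NeZero L] (N : Fin d → ℕ) [hN : ∀ μ, NeZero (N μ)]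

omit [NeZero L] in
/-- the cardinality of the offsets. [folklore] -/
theorem card_offsets : (Fintype.card (Fin d → Fin L) : ℂ) = (L : ℂ) ^ d := by
  rw [Fintype.card_fun, Fintype.card_fin, Fintype.card_fin]; push_cast; ring

/-- the forward box average is a contraction. [folklore] -/
theorem nsq_boxAvg_le (g : Tor (fine L N) → ℂ) : nsq (boxAvg L N g) ≤ nsq g := by
  have h := nsq_avg_transS_le (fine L N) (Finset.univ : Finset (Fin d → Fin L)) (fun j => iota L N j) g
  rwa [Finset.card_univ, card_offsets] at h

omit [NeZero L] hN in
/-- the forward box average commutes with translations. [folklore] -/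
theorem transS_boxAvg (w : Tor (fine L N)) (g : Tor (fine L N) → ℂ) :
    transS (fine L N) w (boxAvg L N g) = boxAvg L N (transS (fine L N) w g) := by
  unfold boxAvg
  rw [transS_smul, transS_sum]

omit [NeZero L] hN in
/-- the forward box average is additive: differences. [folklore] -/
theorem boxAvg_sub (g h : Tor (fine L N) → ℂ) : boxAvg L N (g - h) = boxAvg L N g - boxAvg L N h := by
  unfold boxAvg
  rw [← smul_sub, ← Finset.sum_sub_distrib]
  rfl

/-- the maximal offset `j_max = (L−1, …, L−1)`. [folklore] -/
def jmax : Fin d → Fin L := fun _ => ⟨L - 1, Nat.sub_lt (Nat.pos_of_ne_zero (NeZero.ne L)) Nat.one_pos⟩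

/-- the BACKWARD box average `boxAvgNeg g = L^{−d}Σ_j g(· − ιj)`, realised as the forward one translated back by `ι j_max`
(the offsets `ιj − ιj_max`, `j ∈ [0,L)^d`, are exactly `−ιj′`, `j′ ∈ [0,L)^d`). [folklore] -/
def boxAvgNeg (g : Tor (fine L N) → ℂ) : Tor (fine L N) → ℂ := transS (fine L N) (-iota L N (jmax L)) (boxAvg L N g)

/-- the SMOOTHED function `A g := boxAvg (boxAvgNeg g)` — the separable Fejér (triangle) average of translates, symmetric about `0`. [folklore] -/
def smooth (g : Tor (fine L N) → ℂ) : Tor (fine L N) → ℂ := boxAvg L N (boxAvgNeg L N g)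

/-- the backward box average is a contraction. [folklore] -/
theorem nsq_boxAvgNeg_le (g : Tor (fine L N) → ℂ) : nsq (boxAvgNeg L N g) ≤ nsq g := by
  unfold boxAvgNeg; rw [nsq_transS]; exact nsq_boxAvg_le L N g

/-- the smoothing is a contraction. [folklore] -/
theorem nsq_smooth_le (g : Tor (fine L N) → ℂ) : nsq (smooth L N g) ≤ nsq g :=
  (nsq_boxAvg_le L N _).trans (nsq_boxAvgNeg_le L N g)

omit hN in
/-- the backward box average commutes with translations. [folklore] -/
theorem transS_boxAvgNeg (w : Tor (fine L N)) (g : Tor (fine L N) → ℂ) :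
    transS (fine L N) w (boxAvgNeg L N g) = boxAvgNeg L N (transS (fine L N) w g) := by
  unfold boxAvgNeg
  rw [← transS_add, add_comm, transS_add, transS_boxAvg]

omit hN in
/-- the backward box average is additive: differences. [folklore] -/
theorem boxAvgNeg_sub (g h : Tor (fine L N) → ℂ) : boxAvgNeg L N (g - h) = boxAvgNeg L N g - boxAvgNeg L N h := by
  unfold boxAvgNeg; rw [boxAvg_sub, transS_sub]

omit hN in
/-- the smoothing commutes with translations. [folklore] -/
theorem transS_smooth (w : Tor (fine L N)) (g : Tor (fine L N) → ℂ) :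
    transS (fine L N) w (smooth L N g) = smooth L N (transS (fine L N) w g) := by
  unfold smooth; rw [transS_boxAvg, transS_boxAvgNeg]

omit hN in
/-- the smoothing is additive: differences. [folklore] -/
theorem smooth_sub (g h : Tor (fine L N) → ℂ) : smooth L N (g - h) = smooth L N g - smooth L N h := by
  unfold smooth; rw [boxAvgNeg_sub, boxAvg_sub]

/-! ### the transverse box average (offsets with `j_μ = 0`) -/
/-- the offsets with vanishing `μ`-digit. [folklore] -/
def offsetsT (μ : Fin d) : Finset (Fin d → Fin L) := Finset.univ.filter fun j => j μ = 0

/-- the TRANSVERSE box average in the directions `≠ μ`: the mean of `g(· + ιj)` over the offsets with `j_μ = 0`. [folklore] -/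
def boxAvgT (μ : Fin d) (g : Tor (fine L N) → ℂ) : Tor (fine L N) → ℂ :=
  (((offsetsT L μ).card : ℂ))⁻¹ • ∑ j ∈ offsetsT L μ, transS (fine L N) (iota L N j) g

/-- the transverse box average is a contraction. [folklore] -/
theorem nsq_boxAvgT_le (μ : Fin d) (g : Tor (fine L N) → ℂ) : nsq (boxAvgT L N μ g) ≤ nsq g :=
  nsq_avg_transS_le (fine L N) _ _ g

omit hN in
/-- the transverse box average commutes with translations. [folklore] -/
theorem transS_boxAvgT (μ : Fin d) (w : Tor (fine L N)) (g : Tor (fine L N) → ℂ) :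
    transS (fine L N) w (boxAvgT L N μ g) = boxAvgT L N μ (transS (fine L N) w g) := by
  unfold boxAvgT
  rw [transS_smul, transS_sum]

omit hN in
/-- the transverse box average is additive: differences. [folklore] -/
theorem boxAvgT_sub (μ : Fin d) (g h : Tor (fine L N) → ℂ) : boxAvgT L N μ (g - h) = boxAvgT L N μ g - boxAvgT L N μ h := by
  unfold boxAvgT
  rw [← smul_sub, ← Finset.sum_sub_distrib]
  rfl

omit hN in
/-- the transverse box average is homogeneous. [folklore] -/
theorem boxAvgT_smul (μ : Fin d) (c : ℂ) (g : Tor (fine L N) → ℂ) : boxAvgT L N μ (c • g) = c • boxAvgT L N μ g := by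
  unfold boxAvgT
  have h : ∑ j ∈ offsetsT L μ, transS (fine L N) (iota L N j) (c • g) = c • ∑ j ∈ offsetsT L μ, transS (fine L N) (iota L N j) g := by
    rw [Finset.smul_sum]; rfl
  rw [h, smul_comm]

/-! ## §3 Digit bookkeeping: splitting the offset sum along the `μ`-digit; the telescoping identity -/
omit hN in
/-- moving the `μ`-digit is a translation: `ι(j[μ ↦ t]) = ι(j[μ ↦ 0]) + t e_μ`. [folklore] -/
theorem iota_update (j : Fin d → Fin L) (μ : Fin d) (t : Fin L) :
    iota L N (Function.update j μ t) = iota L N (Function.update j μ 0) + tstep (fine L N) μ (t : ℕ) := by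
  funext ν
  simp only [iota, tstep, Pi.add_apply, Function.update_apply]
  by_cases h : ν = μ
  · subst h; simp
  · simp [h]

/-- **SPLITTING THE OFFSET SUM ALONG THE `μ`-DIGIT**: `Σ_j F(j) = Σ_{j : j_μ = 0} Σ_{t<L} F(j[μ ↦ t])`. [folklore] -/
theorem sum_offsets_split {β : Type*} [AddCommMonoid β] (μ : Fin d) (F : (Fin d → Fin L) → β) :
    ∑ j : Fin d → Fin L, F j = ∑ j ∈ offsetsT L μ, ∑ t : Fin L, F (Function.update j μ t) := by
  rw [← Finset.sum_product (s := offsetsT L μ) (t := (Finset.univ : Finset (Fin L)))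
    (f := fun p : (Fin d → Fin L) × Fin L => F (Function.update p.1 μ p.2))]
  refine Finset.sum_nbij' (fun j => (Function.update j μ 0, j μ)) (fun p => Function.update p.1 μ p.2) ?_ ?_ ?_ ?_ ?_
  · intro j _
    simp [offsetsT, Finset.mem_product]
  · intro p _; exact Finset.mem_univ _
  · intro j _
    simp
  · rintro ⟨j, t⟩ hp
    simp only [offsetsT, Finset.mem_product, Finset.mem_filter, Finset.mem_univ, true_and, and_true] at hp
    ext
    · simp only [Function.update_idem]
      rw [← hp, Function.update_eq_self]
    · simp
  · intro j _
    simp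

/-- the cardinality of the transverse offsets: `|{j : j_μ = 0}|·L = L^d`. [folklore] -/
theorem card_offsetsT_mul (μ : Fin d) : ((offsetsT L μ).card : ℂ) * L = (L : ℂ) ^ d := by
  have h := sum_offsets_split L μ (fun _ => (1 : ℂ))
  simp only [Finset.sum_const, Finset.card_univ, nsmul_eq_mul, mul_one, Fintype.card_fin] at h
  rw [card_offsets] at h
  exact h.symm

omit hN in
/-- **THE TELESCOPING IDENTITY** `(S_μ − 1)∘boxAvg = L⁻¹·boxAvgT μ∘(S_μ^L − 1)`: the forward difference of the forward box average
telescopes along the `μ`-digit to one block step. [folklore] -/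
theorem transS_sub_boxAvg (μ : Fin d) (g : Tor (fine L N) → ℂ) :
    transS (fine L N) (unitVec (fine L N) μ) (boxAvg L N g) - boxAvg L N g
      = ((L : ℂ))⁻¹ • boxAvgT L N μ (transS (fine L N) (tstep (fine L N) μ L) g - g) := by
  have hL : (L : ℂ) ≠ 0 := by exact_mod_cast NeZero.ne L
  have hLd : ((L : ℂ) ^ d) ≠ 0 := pow_ne_zero _ hL
  have hc : ((offsetsT L μ).card : ℂ) ≠ 0 := by
    intro h; have := card_offsetsT_mul L μ; rw [h, zero_mul] at this; exact hLd this.symm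
  -- the difference of the box average as ONE sum of one-step defects
  have e1 : transS (fine L N) (unitVec (fine L N) μ) (boxAvg L N g) - boxAvg L N g
      = ((L : ℂ) ^ d)⁻¹ • ∑ j : Fin d → Fin L, transS (fine L N) (iota L N j)
          (transS (fine L N) (unitVec (fine L N) μ) g - g) := by
    rw [transS_boxAvg]
    unfold boxAvg
    rw [← smul_sub, ← Finset.sum_sub_distrib]
    rfl
  -- split along the μ-digit and telescope each line
  have e2 : ∑ j : Fin d → Fin L, transS (fine L N) (iota L N j) (transS (fine L N) (unitVec (fine L N) μ) g - g)
      = ∑ j ∈ offsetsT L μ, transS (fine L N) (iota L N j) (transS (fine L N) (tstep (fine L N) μ L) g - g) := by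
    rw [sum_offsets_split L μ]
    refine Finset.sum_congr rfl fun j hj => ?_
    have hj0 : j μ = 0 := by simpa [offsetsT] using hj
    have hupd : Function.update j μ 0 = j := by rw [← hj0, Function.update_eq_self]
    have key : ∀ t : Fin L, transS (fine L N) (iota L N (Function.update j μ t)) (transS (fine L N) (unitVec (fine L N) μ) g - g)
        = transS (fine L N) (iota L N j) (transS (fine L N) (tstep (fine L N) μ (t : ℕ))
            (transS (fine L N) (unitVec (fine L N) μ) g - g)) := by
      intro t
      rw [iota_update, hupd, transS_add]
    rw [Finset.sum_congr rfl fun t _ => key t, Fin.sum_univ_eq_sum_range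
      (fun t => transS (fine L N) (iota L N j) (transS (fine L N) (tstep (fine L N) μ t)
        (transS (fine L N) (unitVec (fine L N) μ) g - g))) L]
    rw [← transS_finset_sum, ← transS_tstep_sub]
  rw [e1, e2]
  unfold boxAvgT
  rw [smul_smul]
  congr 1
  rw [← card_offsetsT_mul L μ, mul_inv, mul_comm ((offsetsT L μ).card : ℂ)⁻¹]

/-! ## §4 The energy of the smoothed planting -/
/-- **ENERGY OF THE SMOOTHED PLANTING, DIRECTION `μ`**: `nsq (S_μ(A P f) − A P f) ≤ L^d/L²·nsq (σ_μ f − f)`.  In physical units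
(`Sf = (nL)^{2−d}Σ|∇f′|²`, `Sc = n^{2−d}Σ|∇f|²`) summing over `μ`: `Sf(A P f) ≤ Sc(f)` — constant EXACTLY 1. [folklore] -/
theorem nsq_fdiff_smooth_plant_le (f : Tor N → ℂ) (μ : Fin d) :
    nsq (transS (fine L N) (unitVec (fine L N) μ) (smooth L N (plant L N f)) - smooth L N (plant L N f))
      ≤ (L : ℝ) ^ d / (L : ℝ) ^ 2 * nsq (transS N (unitVec N μ) f - f) := by
  have hL0 : (0 : ℝ) < L := by exact_mod_cast Nat.pos_of_ne_zero (NeZero.ne L)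
  unfold smooth
  rw [transS_sub_boxAvg, transS_boxAvgNeg, ← boxAvgNeg_sub, transS_blockStep_plant, ← plant_sub,
    nsq_smul, norm_inv, Complex.norm_natCast]
  calc ((L : ℝ)⁻¹) ^ 2 * nsq (boxAvgT L N μ (boxAvgNeg L N (plant L N (transS N (unitVec N μ) f - f))))
      ≤ ((L : ℝ)⁻¹) ^ 2 * ((L : ℝ) ^ d * nsq (transS N (unitVec N μ) f - f)) := by
        refine mul_le_mul_of_nonneg_left ?_ (by positivity)
        refine (nsq_boxAvgT_le L N μ _).trans ((nsq_boxAvgNeg_le L N _).trans (le_of_eq (nsq_plant L N _)))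
    _ = (L : ℝ) ^ d / (L : ℝ) ^ 2 * nsq (transS N (unitVec N μ) f - f) := by
        field_simp

/-- **SECOND DIFFERENCES OF THE SMOOTHED PLANTING**: `nsq ((S_μ − 1)²(A P f)) ≤ L^d/L⁴·nsq ((σ_μ − 1)² f)` — both box averages
telescope (the input of the cross-term bound of file 3). [folklore] -/
theorem nsq_fdiff2_smooth_plant_le (f : Tor N → ℂ) (μ : Fin d) :
    nsq (transS (fine L N) (unitVec (fine L N) μ)
            (transS (fine L N) (unitVec (fine L N) μ) (smooth L N (plant L N f)) - smooth L N (plant L N f))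
          - (transS (fine L N) (unitVec (fine L N) μ) (smooth L N (plant L N f)) - smooth L N (plant L N f)))
      ≤ (L : ℝ) ^ d / (L : ℝ) ^ 4 *
        nsq (transS N (unitVec N μ) (transS N (unitVec N μ) f - f) - (transS N (unitVec N μ) f - f)) := by
  have hL0 : (0 : ℝ) < L := by exact_mod_cast Nat.pos_of_ne_zero (NeZero.ne L)
  -- the planted second difference `w₂` and the one-block-step first difference `w₁`
  have hw1 : transS (fine L N) (tstep (fine L N) μ L) (plant L N f) - plant L N f
      = plant L N (transS N (unitVec N μ) f - f) := by
    rw [transS_blockStep_plant, ← plant_sub]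
  have hw2 : transS (fine L N) (tstep (fine L N) μ L) (plant L N (transS N (unitVec N μ) f - f))
        - plant L N (transS N (unitVec N μ) f - f)
      = plant L N (transS N (unitVec N μ) (transS N (unitVec N μ) f - f) - (transS N (unitVec N μ) f - f)) := by
    rw [transS_blockStep_plant, ← plant_sub]
  -- first difference of the outer box average: telescoping, then move everything inside the backward box average
  have h1 : transS (fine L N) (unitVec (fine L N) μ) (smooth L N (plant L N f)) - smooth L N (plant L N f)
      = ((L : ℂ))⁻¹ • boxAvgT L N μ (boxAvgNeg L N (plant L N (transS N (unitVec N μ) f - f))) := by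
    unfold smooth
    rw [transS_sub_boxAvg, transS_boxAvgNeg, ← boxAvgNeg_sub, hw1]
  -- the first difference of a backward box average telescopes as well (it is a translate of a forward one)
  have hneg : ∀ w : Tor (fine L N) → ℂ,
      transS (fine L N) (unitVec (fine L N) μ) (boxAvgNeg L N w) - boxAvgNeg L N w
        = ((L : ℂ))⁻¹ • transS (fine L N) (-iota L N (jmax L))
            (boxAvgT L N μ (transS (fine L N) (tstep (fine L N) μ L) w - w)) := by
    intro w
    unfold boxAvgNeg
    rw [← transS_add, add_comm, transS_add, ← transS_sub, transS_sub_boxAvg, transS_smul]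
  -- second difference
  have h2 : transS (fine L N) (unitVec (fine L N) μ)
          (transS (fine L N) (unitVec (fine L N) μ) (smooth L N (plant L N f)) - smooth L N (plant L N f))
        - (transS (fine L N) (unitVec (fine L N) μ) (smooth L N (plant L N f)) - smooth L N (plant L N f))
      = ((L : ℂ))⁻¹ • (((L : ℂ))⁻¹ • boxAvgT L N μ (transS (fine L N) (-iota L N (jmax L))
          (boxAvgT L N μ (plant L N
            (transS N (unitVec N μ) (transS N (unitVec N μ) f - f) - (transS N (unitVec N μ) f - f)))))) := by
    rw [h1, transS_smul, ← smul_sub, transS_boxAvgT, ← boxAvgT_sub, hneg, hw2, boxAvgT_smul]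
  rw [h2, nsq_smul, nsq_smul, norm_inv, Complex.norm_natCast]
  calc ((L : ℝ)⁻¹) ^ 2 * (((L : ℝ)⁻¹) ^ 2 * nsq (boxAvgT L N μ (transS (fine L N) (-iota L N (jmax L))
          (boxAvgT L N μ (plant L N
            (transS N (unitVec N μ) (transS N (unitVec N μ) f - f) - (transS N (unitVec N μ) f - f)))))))
      ≤ ((L : ℝ)⁻¹) ^ 2 * (((L : ℝ)⁻¹) ^ 2 * ((L : ℝ) ^ d *
          nsq (transS N (unitVec N μ) (transS N (unitVec N μ) f - f) - (transS N (unitVec N μ) f - f)))) := by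
        gcongr
        refine (nsq_boxAvgT_le L N μ _).trans ?_
        rw [nsq_transS]
        exact (nsq_boxAvgT_le L N μ _).trans (le_of_eq (nsq_plant L N _))
    _ = _ := by field_simp

end Boxes

end Summit.QuantumFields.BalabanUV.T4Continuum.VariationalSmoothedPlanting

end
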